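import Mathlib
import HarnessLib
import Summits.NavierStokesRegularity.NavierStokesRegularity.Theorems.TypeILiouvilleSteadySieve
import Literature.Analysis.FluidPDE.TaoQuantitativeTotalSpeed

/-!
# TypeILiouvillePeriodicEternalBridge — crux (L) stmt-NavierStokesRegularity-10661 `TypeIliouvilleL`:
# THE TIME-PERIODIC STRATUM SITS IN THE ETERNAL DOOR (periodic twin of the steady sieve §4)

Helper for stmt-NavierStokesRegularity-10661 (`--supports`); theorems only, no definitions, no named-fact
hypotheses; closes no item; Navier–Stokes regularity is NOT proved here (leafhand seat of the EulerZoomLiouville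
route).  Class P = print's class of bounded ancient mild solutions (`v : ℝ → ℝ³ → ℝ³` continuous and bounded on
`(−∞,0) × ℝ³`, weakly divergence free, `v(t) = e^{(t−s)Δ}v(s) − B¹_s(v,v)(t)` for `s < t < 0`).

In the exact cut `(L) ⟺ EL ∧ BCL ∧ LSL` (`TypeILiouvilleGlobalFading.liouvilleL_iff_three_doors`) the landed steady
sieve (`TypeILiouvilleSteadySieve`) showed that the fading doors L_Q / BCL / LSL (and door stmt-4050) hold OUTRIGHT on
the uniformly recurrent stratum ⊇ steady ∪ time-periodic flows, and that ETERNAL LIOUVILLE EL (stmt-18161) carries the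
bounded STEADY Liouville problem (`steadyLiouville_of_eternalLiouville`).  This file adds the periodic twin:

* §1 `periodic_iter`, `periodic_shift_eq` — iterated backward periodicity `v (t − nP) = v t` (`t < 0`) and the
  resulting independence of `v (t − nP)` from `n` once `t − nP < 0` (any real `t`).
* §2 THE ETERNAL EXTENSION `W t = v (t − (⌈t/P⌉₊ + 1)P)` of a time-periodic class-P flow: it agrees with the shifted
  flow `v (· − NP)` on every half-line `t < NP` (`eternalExt_eq_shift`), hence is continuous, bounded, weakly
  divergence free and Oseen-mild between ALL pairs of times `s < t` (`eternalExt_mild`) — an eternal bounded mild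
  flow in the sense of `TypeILiouvilleShadowExtraction.eternal_package` — and restricts to `v` on `t < 0`.
* §3 `periodicLiouville_of_eternalLiouville` — **EL ⟹ every time-periodic class-P flow is ONE constant vector**;
  `periodicLiouville_of_liouvilleL` — the same from (L) (through the landed `eternalLiouville_of_liouvilleL`).

READING: like the steady wall, the time-periodic wall of (L) («open even in the steady-state case», KNSS 2009 p. 3)
is carried ENTIRELY by the eternal door EL; none of it is asked of the registered residual L_Q
(`TypeILiouvilleSteadySieve.quiescentLiouville_onPeriodic`).
[cite: KochNadirashviliSereginSverak2009, §1 p. 3, §4 (i), Remark 6.1 (arXiv:0709.3599)]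
-/

noncomputable section

open MeasureTheory Filter Set Function Metric
open scoped Topology
open Literature.Analysis Literature.Analysis.FluidPDE Literature.Analysis.UnboundedOperators
open Summit.NavierStokesRegularity.NavierStokesRegularity

set_option linter.dupNamespace false

namespace Summit.NavierStokesRegularity.NavierStokesRegularity.Theorems.TypeILiouvillePeriodicEternal

variable {v : ℝ → EuclideanSpace ℝ (Fin 3) → EuclideanSpace ℝ (Fin 3)} {P : ℝ}

/-! ## §1 Iterated periodicity -/

/-- Backward periodicity iterates: `v (t − nP) = v t` for `t < 0`, `n : ℕ`. [folklore] -/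
theorem periodic_iter (hP : 0 < P) (hper : ∀ t < 0, v (t - P) = v t) :
    ∀ t < 0, ∀ n : ℕ, v (t - n * P) = v t := by
  intro t ht n
  induction n with
  | zero => simp
  | succ n ih =>
    have hnP : (0 : ℝ) ≤ n * P := by positivity
    have h := hper (t - n * P) (by linarith)
    rw [show t - (n : ℝ) * P - P = t - ((n + 1 : ℕ) : ℝ) * P by push_cast; ring] at h
    rw [h, ih]

/-- For ANY real `t`: the shifted values `v (t − mP)`, `v (t − nP)` agree as soon as both shifted times are
negative. [folklore] -/
theorem periodic_shift_eq (hP : 0 < P) (hper : ∀ t < 0, v (t - P) = v t)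
    {t : ℝ} {m n : ℕ} (hm : t - m * P < 0) (hn : t - n * P < 0) :
    v (t - m * P) = v (t - n * P) := by
  wlog hmn : m ≤ n generalizing m n
  · exact (this hn hm (le_of_not_ge hmn)).symm
  obtain ⟨k, rfl⟩ := Nat.exists_eq_add_of_le hmn
  have h := periodic_iter hP hper (t - m * P) hm k
  rw [show t - (m : ℝ) * P - (k : ℝ) * P = t - ((m + k : ℕ) : ℝ) * P by push_cast; ring] at h
  exact h.symm

/-- The canonical shift count `⌈t/P⌉₊ + 1` lands in negative time: `t − (⌈t/P⌉₊ + 1)P < 0`. [folklore] -/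
theorem sub_ceil_mul_neg (hP : 0 < P) (t : ℝ) : t - ((⌈t / P⌉₊ + 1 : ℕ) : ℝ) * P < 0 := by
  have h1 : t / P ≤ (⌈t / P⌉₊ : ℝ) := Nat.le_ceil _
  have h2 : t ≤ (⌈t / P⌉₊ : ℝ) * P := by
    have := mul_le_mul_of_nonneg_right h1 hP.le
    rwa [div_mul_cancel₀ t hP.ne'] at this
  push_cast
  nlinarith

/-! ## §2 The eternal extension of a time-periodic class-P flow -/

/-- On the half-line `t < NP` the eternal extension `t ↦ v (t − (⌈t/P⌉₊+1)P)` is the shifted flow `v (t − NP)`. [folklore] -/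
theorem eternalExt_eq_shift (hP : 0 < P) (hper : ∀ t < 0, v (t - P) = v t)
    {N : ℕ} {t : ℝ} (ht : t - N * P < 0) :
    v (t - ((⌈t / P⌉₊ + 1 : ℕ) : ℝ) * P) = v (t - N * P) :=
  periodic_shift_eq hP hper (sub_ceil_mul_neg hP t) ht

/-- The eternal extension restricts to `v` on negative times. [folklore] -/
theorem eternalExt_eq_of_neg (hP : 0 < P) (hper : ∀ t < 0, v (t - P) = v t) {t : ℝ} (ht : t < 0) :
    v (t - ((⌈t / P⌉₊ + 1 : ℕ) : ℝ) * P) = v t := by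
  have h := eternalExt_eq_shift hP hper (N := 0) (t := t) (by simpa using ht)
  simpa using h

/-- The shifted flow `(t, x) ↦ v (t − c) x` is continuous on `{t < c} × ℝ³`. [folklore] -/
theorem continuousOn_shift (hc : ContinuousOn (uncurry v) (Iio 0 ×ˢ univ)) (c : ℝ) :
    ContinuousOn (uncurry fun t x => v (t - c) x) (Iio c ×ˢ univ) := by
  have hmap : ContinuousOn (fun q : ℝ × EuclideanSpace ℝ (Fin 3) => (q.1 - c, q.2)) (Iio c ×ˢ univ) := by
    fun_prop
  have hmaps : MapsTo (fun q : ℝ × EuclideanSpace ℝ (Fin 3) => (q.1 - c, q.2)) (Iio c ×ˢ univ)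
      (Iio 0 ×ˢ univ) := fun q hq => ⟨by have := (mem_prod.1 hq).1; simp only [mem_Iio] at this ⊢; linarith,
        mem_univ _⟩
  exact (hc.comp hmap hmaps).congr fun q _ => rfl

/-- **The eternal extension is continuous on `ℝ × ℝ³`** (locally it is a shifted copy of `v`). [folklore] -/
theorem eternalExt_continuous (hP : 0 < P) (hper : ∀ t < 0, v (t - P) = v t)
    (hc : ContinuousOn (uncurry v) (Iio 0 ×ˢ univ)) :
    Continuous (uncurry fun t x => v (t - ((⌈t / P⌉₊ + 1 : ℕ) : ℝ) * P) x) := by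
  rw [continuous_iff_continuousAt]
  rintro ⟨t₀, x₀⟩
  set N : ℕ := ⌈t₀ / P⌉₊ + 1 with hN
  have ht₀ : t₀ < N * P := by have := sub_ceil_mul_neg hP t₀; rw [← hN] at this; linarith
  have hopen : IsOpen (Iio ((N : ℝ) * P) ×ˢ (univ : Set (EuclideanSpace ℝ (Fin 3)))) :=
    isOpen_Iio.prod isOpen_univ
  have hmem : (t₀, x₀) ∈ Iio ((N : ℝ) * P) ×ˢ (univ : Set (EuclideanSpace ℝ (Fin 3))) :=
    ⟨mem_Iio.2 ht₀, mem_univ _⟩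
  have hshift : ContinuousAt (uncurry fun t x => v (t - N * P) x) (t₀, x₀) :=
    (continuousOn_shift hc ((N : ℝ) * P)).continuousAt (hopen.mem_nhds hmem)
  refine hshift.congr ?_
  filter_upwards [hopen.mem_nhds hmem] with q hq
  have hq1 : q.1 - N * P < 0 := by have := (mem_prod.1 hq).1; rw [mem_Iio] at this; linarith
  show v (q.1 - N * P) q.2 = v (q.1 - ((⌈q.1 / P⌉₊ + 1 : ℕ) : ℝ) * P) q.2
  rw [eternalExt_eq_shift hP hper hq1]

/-- **The eternal extension is Oseen-mild between ALL pairs of times `s < t`**: on `τ ≤ t < NP` it is the shifted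
flow `v (· − NP)`, whose mild identity between `s − NP < t − NP < 0` is `v`'s (time translation of the Duhamel term,
`oseenDuhamel_translate`, and locality in time, the tree's `oseenDuhamel_congr_Ioo`). [cite: KochNadirashviliSereginSverak2009, §4 (i) (arXiv:0709.3599 p. 8)] -/
theorem eternalExt_mild (hP : 0 < P) (hper : ∀ t < 0, v (t - P) = v t)
    (hm : ∀ s t : ℝ, s < t → t < 0 → ∀ x,
      v t x = heatExtension (v s) (t - s) x - oseenDuhamel 1 s v v t x) :
    ∀ s t : ℝ, s < t → ∀ x,
      (fun t x => v (t - ((⌈t / P⌉₊ + 1 : ℕ) : ℝ) * P) x) t x =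
        heatExtension ((fun t x => v (t - ((⌈t / P⌉₊ + 1 : ℕ) : ℝ) * P) x) s) (t - s) x -
          oseenDuhamel 1 s (fun t x => v (t - ((⌈t / P⌉₊ + 1 : ℕ) : ℝ) * P) x)
            (fun t x => v (t - ((⌈t / P⌉₊ + 1 : ℕ) : ℝ) * P) x) t x := by
  intro s t hst x
  have htN : t - ((⌈t / P⌉₊ + 1 : ℕ) : ℝ) * P < 0 := sub_ceil_mul_neg hP t
  set N : ℕ := ⌈t / P⌉₊ + 1 with hN
  have hsN : s - N * P < 0 := by linarith
  -- on `τ ≤ t` the extension is the shift by `N P`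
  have hWs : (fun y => v (s - ((⌈s / P⌉₊ + 1 : ℕ) : ℝ) * P) y) = v (s - N * P) :=
    funext fun y => by rw [eternalExt_eq_shift hP hper hsN]
  have hWτ : ∀ τ ∈ Ioo s t,
      (fun (τ : ℝ) (y : EuclideanSpace ℝ (Fin 3)) => v (τ - ((⌈τ / P⌉₊ + 1 : ℕ) : ℝ) * P) y) τ =
        (fun (τ : ℝ) => v (τ + -((N : ℝ) * P))) τ := by
    intro τ hτ
    have hτN : τ - N * P < 0 := by linarith [hτ.2]
    funext y
    show v (τ - ((⌈τ / P⌉₊ + 1 : ℕ) : ℝ) * P) y = v (τ + -((N : ℝ) * P)) y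
    rw [eternalExt_eq_shift hP hper hτN, ← sub_eq_add_neg]
  show v (t - N * P) x =
    heatExtension (fun y => v (s - ((⌈s / P⌉₊ + 1 : ℕ) : ℝ) * P) y) (t - s) x -
      oseenDuhamel 1 s (fun τ y => v (τ - ((⌈τ / P⌉₊ + 1 : ℕ) : ℝ) * P) y)
        (fun τ y => v (τ - ((⌈τ / P⌉₊ + 1 : ℕ) : ℝ) * P) y) t x
  rw [hWs, oseenDuhamel_congr_Ioo hWτ hWτ x, oseenDuhamel_translate, ← sub_eq_add_neg, ← sub_eq_add_neg,
    hm (s - N * P) (t - N * P) (by linarith) htN x,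
    show t - (N : ℝ) * P - (s - (N : ℝ) * P) = t - s by ring]

/-- **The eternal extension packaged**: continuous on `ℝ × ℝ³`, weakly divergence free, bounded, Oseen-mild between
all pairs of times, and equal to `v` for `t < 0`. [cite: KochNadirashviliSereginSverak2009, §4 (i) (arXiv:0709.3599 p. 8)] -/
theorem eternalExt_package (hP : 0 < P) (hper : ∀ t < 0, v (t - P) = v t)
    (hc : ContinuousOn (uncurry v) (Iio 0 ×ˢ univ))
    (hK : ∃ K : ℝ, ∀ t < 0, ∀ x, ‖v t x‖ ≤ K)
    (hd : ∀ t < 0, IsWeaklyDivFree (v t))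
    (hm : ∀ s t : ℝ, s < t → t < 0 → ∀ x,
      v t x = heatExtension (v s) (t - s) x - oseenDuhamel 1 s v v t x) :
    ∃ (W : ℝ → EuclideanSpace ℝ (Fin 3) → EuclideanSpace ℝ (Fin 3)) (C : ℝ),
      Continuous (uncurry W) ∧ (∀ t, IsWeaklyDivFree (W t)) ∧ (∀ t x, ‖W t x‖ ≤ C) ∧
      (∀ s t : ℝ, s < t → ∀ x, W t x = heatExtension (W s) (t - s) x - oseenDuhamel 1 s W W t x) ∧
      (∀ t < 0, W t = v t) := by
  obtain ⟨K, hKb⟩ := hK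
  refine ⟨fun t x => v (t - ((⌈t / P⌉₊ + 1 : ℕ) : ℝ) * P) x, K, eternalExt_continuous hP hper hc,
    fun t => hd _ (sub_ceil_mul_neg hP t), fun t x => hKb _ (sub_ceil_mul_neg hP t) x,
    eternalExt_mild hP hper hm, fun t ht => ?_⟩
  funext x
  exact congrFun (eternalExt_eq_of_neg hP hper ht) x

/-! ## §3 The periodic stratum of (L) is carried by ETERNAL LIOUVILLE -/

/-- **EL ⟹ TIME-PERIODIC BOUNDED LIOUVILLE.**  Under ETERNAL LIOUVILLE (stmt-NavierStokesRegularity-18161,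
`Theses.TypeTwoEternal.EternalLiouville`, BY NAME) every time-periodic class-P flow (`v (t − P) = v t` for `t < 0`,
some `P > 0`) is ONE constant vector: its eternal extension is in EL's class (`eternalExt_package` +
`TypeILiouvilleShadowExtraction.eternal_package`), so every slice is a constant `b(t)`, and the `b(t)` of a class-P flow
agree (KNSS Remark 6.1). [cite: KochNadirashviliSereginSverak2009, §1 p. 3 and Remark 6.1 (arXiv:0709.3599)] -/
theorem periodicLiouville_of_eternalLiouville (hE : Theses.TypeTwoEternal.EternalLiouville) :
    ∀ v : ℝ → EuclideanSpace ℝ (Fin 3) → EuclideanSpace ℝ (Fin 3),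
      ContinuousOn (uncurry v) (Iio 0 ×ˢ univ) →
      (∃ K : ℝ, ∀ t < 0, ∀ x, ‖v t x‖ ≤ K) →
      (∀ t < 0, IsWeaklyDivFree (v t)) →
      (∀ s t : ℝ, s < t → t < 0 → ∀ x,
        v t x = heatExtension (v s) (t - s) x - oseenDuhamel 1 s v v t x) →
      (∃ P : ℝ, 0 < P ∧ ∀ t < 0, v (t - P) = v t) →
      ∃ b : EuclideanSpace ℝ (Fin 3), ∀ t < 0, ∀ x, v t x = b := by
  classical
  intro v hc hK hd hm hper
  obtain ⟨P, hP, hper⟩ := hper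
  obtain ⟨W, C, hWc, hWd, hWb, hWm, hWv⟩ := eternalExt_package hP hper hc hK hd hm
  obtain ⟨h1, h2, h3, h4⟩ :=
    TypeILiouvilleShadowExtraction.eternal_package (W := W) (C := C) hWc hWd hWb hWm
  have hslice : ∀ t < 0, ∃ b : EuclideanSpace ℝ (Fin 3), ∀ x, v t x = b := by
    intro t ht
    obtain ⟨b, hb⟩ := hE W h1 h2 h3 h4 t
    exact ⟨b, fun x => by rw [← hWv t ht]; exact hb x⟩
  set b : ℝ → EuclideanSpace ℝ (Fin 3) := fun t =>
    if ht : t < 0 then Classical.choose (hslice t ht) else 0 with hb_def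
  have hub : ∀ t < 0, ∀ x, v t x = b t := by
    intro t ht x
    have h := Classical.choose_spec (hslice t ht) x
    simp only [hb_def, dif_pos ht]
    exact h
  have htime : ∀ s t : ℝ, s < 0 → t < 0 → b s = b t :=
    KNSS2009_remark61 one_pos hub fun s t hst ht => Eventually.of_forall fun x => by
      rw [one_mul]; exact hm s t hst ht x
  exact ⟨b (-1), fun t ht x => by rw [hub t ht x, htime t (-1) ht (by norm_num)]⟩

/-- **(L) ⟹ TIME-PERIODIC BOUNDED LIOUVILLE** (through the landed `eternalLiouville_of_liouvilleL`): in the exact cut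
`(L) ⟺ EL ∧ BCL ∧ LSL` the time-periodic wall, like the steady one, is sieved ENTIRELY into the eternal door.
[cite: KochNadirashviliSereginSverak2009, §1 p. 3 (arXiv:0709.3599)] -/
theorem periodicLiouville_of_liouvilleL (hL : Theses.TypeILiouville.TypeIliouvilleL) :
    ∀ v : ℝ → EuclideanSpace ℝ (Fin 3) → EuclideanSpace ℝ (Fin 3),
      ContinuousOn (uncurry v) (Iio 0 ×ˢ univ) →
      (∃ K : ℝ, ∀ t < 0, ∀ x, ‖v t x‖ ≤ K) →
      (∀ t < 0, IsWeaklyDivFree (v t)) →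
      (∀ s t : ℝ, s < t → t < 0 → ∀ x,
        v t x = heatExtension (v s) (t - s) x - oseenDuhamel 1 s v v t x) →
      (∃ P : ℝ, 0 < P ∧ ∀ t < 0, v (t - P) = v t) →
      ∃ b : EuclideanSpace ℝ (Fin 3), ∀ t < 0, ∀ x, v t x = b :=
  periodicLiouville_of_eternalLiouville (TypeILiouvilleQuiescentShadow.eternalLiouville_of_liouvilleL hL)

end Summit.NavierStokesRegularity.NavierStokesRegularity.Theorems.TypeILiouvillePeriodicEternal

end
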